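import Literature.Barriers.NavierStokesRegularity.NavierStokesInequalityOscillatoryProcesses
import HarnessLib

/-!
# Oscillatory processes for Scheffer's Cantor block, I: multi-frequency square waves (Ożański 2017, §6.4)

Support file on the discharge path of the named fact
`Literature.Barriers.NavierStokesRegularity.NSICantorBlock_of_arrangement` (fact D′ of
`NavierStokesInequalityCantorArrangement`: the level data of a geometric arrangement for
Theorem 14, i.e. Ożański's Proposition 16 with (6.8)–(6.12)). Proposition 16 is proved
(arXiv:1709.00602v4, §6.3) from the **new oscillatory processes** of **Theorem 17** (§6.4): for
`𝔐` pairs of structures one needs processes `a_i^{𝔪,k} ∈ C^∞(ℝ;[-1,1])`, `i = 1,2`,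
`𝔪 = 1,…,𝔐`, such that `∫₀ᵗ a_i^{𝔪,k}(s)(G_i^𝔪(x,s) + Σ_{l,𝔫} F_{i,l}^{𝔪,𝔫}(x,s,a_l^{𝔫,k}(s))) ds`
converges, uniformly, to `½∫₀ᵗ(F_{2,1}^{𝔪,𝔪}(x,s,1) - F_{2,1}^{𝔪,𝔪}(x,s,0)) ds` for `i = 2` and to
`0` for `i = 1` ((6.27)). Ożański's construction (p. 32): "we can obtain the processes
`a_i^{𝔪,k}` by finding processes `b_i^{(𝔪)}` such that
(6.28) `∫₀ᵀ b_i^{(𝔪)}(s) f(b_l^{(𝔫)}(s)) ds = T/2 (f(1) - f(0))` if `(i,l) = (2,1)`, `𝔫 = 𝔪`, and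
`= 0` otherwise, for any `f` with `f(-1) = f(1)`. Such processes can be obtained by letting
`b_1^{(1)} := b₁`, `b_2^{(1)} := b₂` and letting `b_i^{(𝔪)}` have `4` times higher frequency than
`b_i^{(𝔪-1)}` … (6.29) `b_i^{𝔪,k}(t) := b_i(k4^{𝔪-1}t)`. We omit the detailed calculation." This
file supplies that calculation, on top of the accepted period-`4` square waves `Scheffer.wave`
of `NavierStokesInequalityOscillation` (= the `𝔐 = 1` case, Theorem 10):

* `Scheffer.IsCellConst h n e` — functions constant on each open cell `(jh, (j+1)h)`, `j < n`, of
  a grid (all the square waves `wave c (4ᵃh)` and their products and compositions are, on the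
  finest grid, `IsCellConst.refine`); `IsCellConst.intervalIntegrable_mul` — `e · ψ` is
  integrable for `ψ` continuous;
* `Scheffer.abs_integral_mul_sub_le_of_period` — **the averaging estimate for a general bounded
  pattern** `e` (`|e| ≤ 1`) with prescribed period integrals `∫_{αp}^{(α+1)p} e = pA`:
  `|∫₀ᵗ e φ - A ∫₀ᵗ φ| ≤ 2εT + 2Np` for `φ` with `|φ| ≤ N` and modulus `ε` at scale `p`
  (Ożański's computation (4.30)–(4.31), verbatim for any pattern; the accepted
  `abs_integral_wave_mul_sub_le` is the case `e = wave c h`, `p = 4h`);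
* the period integrals of the **multi-frequency patterns** `wave c (4ᵃh) · g(wave c' (4ᵃ'h))`
  over a common period `P = 4^{A+1}h` (`a, a' ≤ A`): `P(Σ_q c_q g(c'_q))/4` at the same
  frequency and `0` at different frequencies when `Σ c = 0` (the "block" computations behind
  (6.28): on a quarter of the slower wave the faster wave runs through whole periods —
  `integral_wave_periods`, `integral_wave_mul_coarse_quarter`, `integral_wave_mul_fine_period`,
  `integral_wave_mul_wave_commonPeriod_of_ne`, `integral_wave_mul_wave_commonPeriod_self`);
* `Scheffer.sum_quarterValues_mul_apply` — the discrete form of (6.28) for Ożański's quarter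
  values `c¹ = (1,-1,0,0)`, `c² = (1,1,-1,-1)`: `¼Σ_q cⁱ_q f(cˡ_q) = ½(f(1) - f(0))` for
  `(i,l) = (2,1)` and `0` otherwise, when `f(-1) = f(1)`.

The sequel (`NavierStokesInequalityCantorOscillatoryProcesses`) smooths the waves at all
frequencies with a common transition width and assembles Theorem 17.

## References

* W. S. Ożański, arXiv:1709.00602v4 (2017/2019), §6.4: Theorem 17, (6.27)–(6.29); §4.3:
  (4.24)–(4.25), (4.30)–(4.31). [`Ozanski2017NSISingular`]
* V. Scheffer, Comm. Math. Phys. 110 (1987), §3, Lemmas 3.1–3.2 (the original oscillatory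
  process). [`Scheffer1987`]
-/

noncomputable section

open Set MeasureTheory intervalIntegral Function
open scoped Interval

namespace Literature.Barriers.NavierStokesRegularity

namespace Scheffer

/-! ### Cellwise constant functions -/

/-- `e` is constant on each open cell `(jh, (j+1)h)`, `j < n`, of the grid of mesh `h` (the
square waves of Ożański's (4.24)/(6.29) and all their products and compositions are of this
kind on the finest grid). [folklore] -/
def IsCellConst (h : ℝ) (n : ℕ) (e : ℝ → ℝ) : Prop :=
  ∀ j < n, ∃ v : ℝ, EqOn e (fun _ => v) (Ioo ((j : ℝ) * h) (((j : ℝ) + 1) * h))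

namespace IsCellConst

variable {h : ℝ} {n : ℕ} {e f : ℝ → ℝ}

/-- Constants are cellwise constant. [folklore] -/
theorem const (h : ℝ) (n : ℕ) (v : ℝ) : IsCellConst h n fun _ => v :=
  fun _ _ => ⟨v, fun _ _ => rfl⟩

/-- Products of cellwise constant functions are cellwise constant. [folklore] -/
theorem mul (he : IsCellConst h n e) (hf : IsCellConst h n f) :
    IsCellConst h n fun s => e s * f s := by
  intro j hj
  obtain ⟨v, hv⟩ := he j hj
  obtain ⟨v', hv'⟩ := hf j hj
  exact ⟨v * v', fun s hs => by simp only [hv hs, hv' hs]⟩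

/-- Compositions `g ∘ e` of a cellwise constant `e` are cellwise constant. [folklore] -/
theorem comp (he : IsCellConst h n e) (g : ℝ → ℝ) : IsCellConst h n fun s => g (e s) := by
  intro j hj
  obtain ⟨v, hv⟩ := he j hj
  exact ⟨g v, fun s hs => by simp only [hv hs]⟩

/-- Fewer cells. [folklore] -/
theorem mono (he : IsCellConst h n e) {m : ℕ} (hm : m ≤ n) : IsCellConst h m e :=
  fun j hj => he j (lt_of_lt_of_le hj hm)

/-- **Refinement**: a function constant on the cells of the coarse grid of mesh `dh` (`n` cells)
is constant on the cells of the fine grid of mesh `h` (`dn` cells) — each fine cell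
`(jh, (j+1)h)` lies in the coarse cell of index `⌊j/d⌋`. [folklore] -/
theorem refine (hh : 0 ≤ h) {d : ℕ} (hd : 0 < d) (he : IsCellConst ((d : ℝ) * h) n e) :
    IsCellConst h (d * n) e := by
  intro j hj
  have hjd : j / d < n := (Nat.div_lt_iff_lt_mul hd).2 (by rwa [mul_comm] at hj)
  obtain ⟨v, hv⟩ := he (j / d) hjd
  refine ⟨v, fun s hs => hv ⟨?_, ?_⟩⟩
  · have h1 : (((j / d : ℕ) : ℝ)) * d ≤ j := by exact_mod_cast Nat.div_mul_le_self j d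
    calc ((j / d : ℕ) : ℝ) * ((d : ℝ) * h) = ((j / d : ℕ) : ℝ) * d * h := by ring
      _ ≤ (j : ℝ) * h := mul_le_mul_of_nonneg_right h1 hh
      _ < s := hs.1
  · have h2 : (j : ℝ) + 1 ≤ (((j / d : ℕ) : ℝ) + 1) * d := by
      have := Nat.lt_div_mul_add (a := j) hd
      have h3 : j + 1 ≤ j / d * d + d := this
      have h4 : ((j + 1 : ℕ) : ℝ) ≤ ((j / d * d + d : ℕ) : ℝ) := by exact_mod_cast h3
      push_cast at h4
      linarith
    calc s < ((j : ℝ) + 1) * h := hs.2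
      _ ≤ (((j / d : ℕ) : ℝ) + 1) * d * h := mul_le_mul_of_nonneg_right h2 hh
      _ = (((j / d : ℕ) : ℝ) + 1) * ((d : ℝ) * h) := by ring

/-- **Integrability of `e · ψ`** on `[0, nh]` for `e` cellwise constant and `ψ` continuous on
`[0, nh]` (cell by cell the product is a constant multiple of `ψ`). [folklore] -/
theorem intervalIntegrable_mul (hh : 0 < h) (he : IsCellConst h n e) {ψ : ℝ → ℝ}
    (hψ : ContinuousOn ψ (Icc 0 ((n : ℝ) * h))) :
    IntervalIntegrable (fun s => e s * ψ s) volume 0 ((n : ℝ) * h) := by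
  have key := IntervalIntegrable.trans_iterate (f := fun s => e s * ψ s) (μ := volume)
    (a := fun i : ℕ => (i : ℝ) * h) (n := n) fun i hi => by
      obtain ⟨v, hv⟩ := he i hi
      have hle : (i : ℝ) * h ≤ ((i : ℝ) + 1) * h := by nlinarith
      have hsub : Icc ((i : ℝ) * h) (((i : ℝ) + 1) * h) ⊆ Icc 0 ((n : ℝ) * h) := by
        refine Icc_subset_Icc (by positivity) ?_
        have : (i : ℝ) + 1 ≤ n := by exact_mod_cast hi
        nlinarith
      have hcont : ContinuousOn (fun s => v * ψ s) (uIcc ((i : ℝ) * h) (((i : ℝ) + 1) * h)) := by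
        rw [uIcc_of_le hle]
        exact continuousOn_const.mul (hψ.mono hsub)
      push_cast
      refine (hcont.intervalIntegrable).congr_uIoo ?_
      rw [uIoo_of_le hle]
      intro s hs
      simp only [hv hs]
  simpa using key

/-- Integrability of `e · ψ` on any subinterval `[u, v] ⊆ [0, nh]`. [folklore] -/
theorem intervalIntegrable_mul_of_mem (hh : 0 < h) (he : IsCellConst h n e) {ψ : ℝ → ℝ}
    (hψ : ContinuousOn ψ (Icc 0 ((n : ℝ) * h))) {u v : ℝ} (hu : u ∈ Icc 0 ((n : ℝ) * h))
    (hv : v ∈ Icc 0 ((n : ℝ) * h)) :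
    IntervalIntegrable (fun s => e s * ψ s) volume u v := by
  refine (he.intervalIntegrable_mul hh hψ).mono_set ?_
  rw [uIcc_of_le (by positivity : (0 : ℝ) ≤ (n : ℝ) * h)]
  exact uIcc_subset_Icc hu hv

/-- Integrability of `e` itself on subintervals of `[0, nh]`. [folklore] -/
theorem intervalIntegrable_of_mem (hh : 0 < h) (he : IsCellConst h n e) {u v : ℝ}
    (hu : u ∈ Icc 0 ((n : ℝ) * h)) (hv : v ∈ Icc 0 ((n : ℝ) * h)) :
    IntervalIntegrable e volume u v := by
  have := he.intervalIntegrable_mul_of_mem hh (ψ := fun _ => 1) continuousOn_const hu hv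
  simpa using this

end IsCellConst

/-- The square wave of quarter length `h` is cellwise constant on the grid of mesh `h`.
[cite: Ozanski2017NSISingular, §4.3 (4.24)] -/
theorem isCellConst_wave {h : ℝ} (hh : 0 < h) (c : Fin 4 → ℝ) (n : ℕ) :
    IsCellConst h n (wave c h) := fun j _ =>
  ⟨c ⟨j % 4, Nat.mod_lt _ (by norm_num)⟩, wave_eqOn hh c j⟩

/-- The square wave of quarter length `4ᵃh` (Ożański's `b_i^{(𝔪)}`, of "`4` times higher
frequency than `b_i^{(𝔪-1)}`", read downwards from the slowest) is cellwise constant on the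
fine grid of mesh `h`. [cite: Ozanski2017NSISingular, §6.4 (6.29)] -/
theorem isCellConst_wave_pow {h : ℝ} (hh : 0 < h) (c : Fin 4 → ℝ) (a n : ℕ) :
    IsCellConst h (4 ^ a * n) (wave c (4 ^ a * h)) := by
  have h1 : IsCellConst (((4 ^ a : ℕ) : ℝ) * h) n (wave c (4 ^ a * h)) := by
    push_cast
    exact isCellConst_wave (by positivity) c n
  exact h1.refine hh.le (by positivity)

/-! ### The averaging estimate for a general pattern (Ożański (4.30)–(4.31)) -/

/-- **One full period, general pattern.** If `|e| ≤ M`, `∫_{a}^{b} e = 0`, `e · ψ` and `e` are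
integrable on `[a,b]`, and `ψ` oscillates by at most `ε` from `ψ(a)` on `[a,b]`, then
`|∫_a^b e ψ| ≤ M ε (b - a)` (the computation (4.30): subtract `ψ(a)` and use `∫ e = 0`).
[cite: Ozanski2017NSISingular, §4.3 (4.30)] -/
theorem abs_integral_mul_le_of_integral_eq_zero {a b M ε : ℝ} (hab : a ≤ b) {e ψ : ℝ → ℝ}
    (hM : ∀ s, |e s| ≤ M) (he0 : ∫ s in a..b, e s = 0)
    (hI : IntervalIntegrable (fun s => e s * ψ s) volume a b)
    (hIe : IntervalIntegrable e volume a b)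
    (hε : ∀ s ∈ Icc a b, |ψ s - ψ a| ≤ ε) :
    |∫ s in a..b, e s * ψ s| ≤ M * ε * (b - a) := by
  have h2 : IntervalIntegrable (fun s => e s * ψ a) volume a b := hIe.mul_const _
  have h1 : IntervalIntegrable (fun s => e s * (ψ s - ψ a)) volume a b := by
    have := hI.sub h2
    refine this.congr fun s _ => ?_
    show e s * ψ s - e s * ψ a = e s * (ψ s - ψ a)
    ring
  have hsplit : ∫ s in a..b, e s * ψ s =
      (∫ s in a..b, e s * (ψ s - ψ a)) + ∫ s in a..b, e s * ψ a := by
    rw [← intervalIntegral.integral_add h1 h2]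
    congr 1
    funext s
    ring
  have hzero : ∫ s in a..b, e s * ψ a = 0 := by
    rw [intervalIntegral.integral_mul_const, he0, zero_mul]
  rw [hsplit, hzero, add_zero]
  have hM0 : 0 ≤ M := (abs_nonneg _).trans (hM a)
  have hbound : ∀ s ∈ Ι a b, ‖e s * (ψ s - ψ a)‖ ≤ M * ε := by
    intro s hs
    rw [uIoc_of_le hab] at hs
    rw [Real.norm_eq_abs, abs_mul]
    exact mul_le_mul (hM _) (hε s ⟨hs.1.le, hs.2⟩) (abs_nonneg _) hM0
  have := norm_integral_le_of_norm_le_const hbound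
  rw [Real.norm_eq_abs, abs_of_nonneg (sub_nonneg.2 hab)] at this
  linarith

/-- **Ożański's averaging estimate for a general bounded pattern** ((4.30)–(4.31), verbatim for
any pattern in place of the square wave). Let `p > 0`, `K ≥ 1`, `T = Kp`; let `e` be a pattern
with `|e| ≤ 1`, such that `e · ψ` is integrable on subintervals of `[0,T]` for every continuous
`ψ`, and with prescribed period integrals `∫_{αp}^{(α+1)p} e = pA` (`α < K`, `|A| ≤ 1`). Let `φ`
be continuous on `[0,T]`, `|φ| ≤ N`, `|φ(s) - φ(s')| ≤ ε` for `|s - s'| ≤ p`. Then for all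
`t ∈ [0,T]`: `|∫₀ᵗ e φ - A ∫₀ᵗ φ| ≤ 2εT + 2Np` (the `q ≤ K` full periods below `t` contribute
`≤ 2εp` each, by `abs_integral_mul_le_of_integral_eq_zero` for the centred pattern `e - A`,
`|e - A| ≤ 2`; the incomplete last period contributes `≤ 2Np`).
[cite: Ozanski2017NSISingular, §4.3 (4.30)–(4.31) and §6.4 p. 32] -/
theorem abs_integral_mul_sub_le_of_period {p : ℝ} (hp : 0 < p) {K : ℕ} (hK : 0 < K)
    {e : ℝ → ℝ} (he1 : ∀ s, |e s| ≤ 1)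
    (hI : ∀ {ψ : ℝ → ℝ}, ContinuousOn ψ (Icc 0 ((K : ℝ) * p)) → ∀ {u v : ℝ},
      u ∈ Icc 0 ((K : ℝ) * p) → v ∈ Icc 0 ((K : ℝ) * p) →
      IntervalIntegrable (fun s => e s * ψ s) volume u v)
    {A : ℝ} (hA1 : |A| ≤ 1)
    (hA : ∀ α : ℕ, α < K → ∫ s in ((α : ℝ) * p)..(((α : ℝ) + 1) * p), e s = p * A)
    {φ : ℝ → ℝ} (hφ : ContinuousOn φ (Icc 0 ((K : ℝ) * p))) {N ε : ℝ}
    (hN : ∀ s ∈ Icc 0 ((K : ℝ) * p), |φ s| ≤ N)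
    (hε : ∀ s ∈ Icc 0 ((K : ℝ) * p), ∀ s' ∈ Icc 0 ((K : ℝ) * p),
      |s - s'| ≤ p → |φ s - φ s'| ≤ ε)
    {t : ℝ} (ht : t ∈ Icc 0 ((K : ℝ) * p)) :
    |(∫ s in 0..t, e s * φ s) - A * ∫ s in 0..t, φ s| ≤ 2 * ε * ((K : ℝ) * p) + 2 * N * p := by
  set T : ℝ := (K : ℝ) * p with hT_def
  have hTpos : 0 < T := by positivity
  have hε0 : 0 ≤ ε := by
    have := hε 0 ⟨le_rfl, hTpos.le⟩ 0 ⟨le_rfl, hTpos.le⟩ (by simp; positivity)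
    simpa using this
  have hN0 : 0 ≤ N := (abs_nonneg _).trans (hN 0 ⟨le_rfl, hTpos.le⟩)
  -- the centred pattern
  set e' : ℝ → ℝ := fun s => e s - A with he'_def
  have he' : ∀ s, |e' s| ≤ 2 := fun s => by
    calc |e s - A| ≤ |e s| + |A| := abs_sub _ _
      _ ≤ 1 + 1 := add_le_add (he1 s) hA1
      _ = 2 := by norm_num
  have h0T : (0 : ℝ) ∈ Icc 0 T := ⟨le_rfl, hTpos.le⟩
  have hIφ : ∀ {u v : ℝ}, u ∈ Icc 0 T → v ∈ Icc 0 T →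
      IntervalIntegrable φ volume u v := fun hu hv =>
    (hφ.mono (uIcc_subset_Icc hu hv)).intervalIntegrable
  have hIe'ψ : ∀ {ψ : ℝ → ℝ}, ContinuousOn ψ (Icc 0 T) → ∀ {u v : ℝ}, u ∈ Icc 0 T → v ∈ Icc 0 T →
      IntervalIntegrable (fun s => e' s * ψ s) volume u v := fun {ψ} hψ {u v} hu hv => by
    have h1 := hI hψ hu hv
    have h2 : IntervalIntegrable (fun s => A * ψ s) volume u v :=
      ((hψ.mono (uIcc_subset_Icc hu hv)).intervalIntegrable).const_mul A
    refine (h1.sub h2).congr fun s _ => ?_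
    show e s * ψ s - A * ψ s = (e s - A) * ψ s
    ring
  have hIe' : ∀ {u v : ℝ}, u ∈ Icc 0 T → v ∈ Icc 0 T → IntervalIntegrable e' volume u v :=
    fun hu hv => by
    have := hIe'ψ (ψ := fun _ => 1) continuousOn_const hu hv
    simpa using this
  have key : (∫ s in 0..t, e s * φ s) - A * ∫ s in 0..t, φ s = ∫ s in 0..t, e' s * φ s := by
    rw [← intervalIntegral.integral_const_mul, ← intervalIntegral.integral_sub (hI hφ h0T ht)
      ((hIφ h0T ht).const_mul A)]
    congr 1
    funext s
    simp only [he'_def]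
    ring
  rw [key]
  -- the number `q` of full periods below `t`
  obtain ⟨q, hq1, hq2, hqk⟩ : ∃ q : ℕ, (q : ℝ) * p ≤ t ∧ t < ((q : ℝ) + 1) * p ∧ q ≤ K := by
    have ht0 : 0 ≤ t / p := div_nonneg ht.1 hp.le
    have hfl : 0 ≤ ⌊t / p⌋ := Int.floor_nonneg.2 ht0
    have h3 : ((⌊t / p⌋.toNat : ℕ) : ℝ) = (⌊t / p⌋ : ℝ) := by
      have h1 : ((⌊t / p⌋.toNat : ℤ) : ℝ) = (⌊t / p⌋ : ℝ) := by
        rw [Int.toNat_of_nonneg hfl]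
      exact_mod_cast h1
    refine ⟨⌊t / p⌋.toNat, ?_, ?_, ?_⟩
    · have h2 : (⌊t / p⌋ : ℝ) ≤ t / p := Int.floor_le _
      rw [le_div_iff₀ hp] at h2
      rw [h3]; exact h2
    · have h2 : t / p < (⌊t / p⌋ : ℝ) + 1 := Int.lt_floor_add_one _
      rw [div_lt_iff₀ hp] at h2
      rw [h3]; exact h2
    · have h2 : t / p ≤ K := by
        rw [div_le_iff₀ hp]
        exact ht.2
      have h4 : ⌊t / p⌋ ≤ (K : ℤ) := by
        have : ⌊t / p⌋ ≤ ⌊((K : ℤ) : ℝ)⌋ := Int.floor_le_floor (by exact_mod_cast h2)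
        rwa [Int.floor_intCast] at this
      have h5 : (⌊t / p⌋.toNat : ℤ) ≤ K := by
        rw [Int.toNat_of_nonneg hfl]; exact h4
      exact_mod_cast h5
  -- endpoints of the full periods
  have hper_mem : ∀ r : ℕ, r ≤ q → (r : ℝ) * p ∈ Icc 0 T := fun r hr => by
    refine ⟨by positivity, ?_⟩
    have : (r : ℝ) ≤ K := by exact_mod_cast hr.trans hqk
    exact mul_le_mul_of_nonneg_right this hp.le
  have hqT : (q : ℝ) * p ∈ Icc 0 T := hper_mem q le_rfl
  -- split off the incomplete last period
  rw [← integral_add_adjacent_intervals (b := (q : ℝ) * p) (hIe'ψ hφ h0T hqT) (hIe'ψ hφ hqT ht)]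
  -- (i) the full periods
  have hfull : |∫ s in 0..(q : ℝ) * p, e' s * φ s| ≤ 2 * ε * T := by
    have hsum := sum_integral_adjacent_intervals (f := fun s => e' s * φ s) (μ := volume)
      (a := fun r : ℕ => (r : ℝ) * p) (n := q) fun r hr =>
        hIe'ψ hφ (hper_mem r hr.le) (by
          have := hper_mem (r + 1) hr
          push_cast at this ⊢
          exact this)
    simp only [Nat.cast_zero, zero_mul] at hsum
    rw [← hsum]
    have hterm : ∀ r ∈ Finset.range q,
        |∫ s in (r : ℝ) * p..((r + 1 : ℕ) : ℝ) * p, e' s * φ s| ≤ 2 * ε * p := by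
      intro r hr
      rw [Finset.mem_range] at hr
      have hr0 := hper_mem r hr.le
      have hr1 : ((r : ℝ) + 1) * p ∈ Icc 0 T := by
        have := hper_mem (r + 1) hr
        push_cast at this
        exact this
      have hle : (r : ℝ) * p ≤ ((r : ℝ) + 1) * p := by nlinarith
      push_cast
      have he'0 : ∫ s in ((r : ℝ) * p)..(((r : ℝ) + 1) * p), e' s = 0 := by
        have h1 : IntervalIntegrable e volume ((r : ℝ) * p) (((r : ℝ) + 1) * p) := by
          have := hI (ψ := fun _ => 1) continuousOn_const hr0 hr1
          simpa using this
        rw [he'_def, intervalIntegral.integral_sub h1 intervalIntegrable_const,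
          hA r (lt_of_lt_of_le hr hqk), intervalIntegral.integral_const, smul_eq_mul]
        ring
      have := abs_integral_mul_le_of_integral_eq_zero hle he' he'0 (hIe'ψ hφ hr0 hr1)
        (hIe' hr0 hr1) (ε := ε) fun s hs => ?_
      · calc |∫ s in (r : ℝ) * p..((r : ℝ) + 1) * p, e' s * φ s| ≤ 2 * ε * (((r : ℝ) + 1) * p - r * p) :=
            this
          _ = 2 * ε * p := by ring
      · refine hε s ⟨hr0.1.trans hs.1, hs.2.trans hr1.2⟩ _ hr0 ?_
        rw [abs_of_nonneg (sub_nonneg.2 hs.1)]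
        linarith [hs.2]
    calc |∑ r ∈ Finset.range q, ∫ s in (r : ℝ) * p..((r + 1 : ℕ) : ℝ) * p, e' s * φ s|
        ≤ ∑ r ∈ Finset.range q, |∫ s in (r : ℝ) * p..((r + 1 : ℕ) : ℝ) * p, e' s * φ s| :=
          Finset.abs_sum_le_sum_abs _ _
      _ ≤ ∑ _r ∈ Finset.range q, 2 * ε * p := Finset.sum_le_sum hterm
      _ = q * (2 * ε * p) := by rw [Finset.sum_const, Finset.card_range, nsmul_eq_mul]
      _ ≤ K * (2 * ε * p) := by
          have : (q : ℝ) ≤ K := by exact_mod_cast hqk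
          exact mul_le_mul_of_nonneg_right this (by positivity)
      _ = 2 * ε * T := by rw [hT_def]; ring
  -- (ii) the incomplete last period
  have hrest : |∫ s in (q : ℝ) * p..t, e' s * φ s| ≤ 2 * N * p := by
    have hbound : ∀ s ∈ Ι ((q : ℝ) * p) t, ‖e' s * φ s‖ ≤ 2 * N := by
      intro s hs
      rw [uIoc_of_le hq1] at hs
      rw [Real.norm_eq_abs, abs_mul]
      exact mul_le_mul (he' _) (hN s ⟨hqT.1.trans hs.1.le, hs.2.trans ht.2⟩) (abs_nonneg _)
        (by norm_num)
    have h1 := norm_integral_le_of_norm_le_const hbound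
    rw [Real.norm_eq_abs, abs_of_nonneg (sub_nonneg.2 hq1)] at h1
    have h2 : t - (q : ℝ) * p ≤ p := by nlinarith
    calc |∫ s in (q : ℝ) * p..t, e' s * φ s| ≤ 2 * N * (t - (q : ℝ) * p) := h1
      _ ≤ 2 * N * p := mul_le_mul_of_nonneg_left h2 (by positivity)
  calc |(∫ s in 0..(q : ℝ) * p, e' s * φ s) + ∫ s in (q : ℝ) * p..t, e' s * φ s|
      ≤ |∫ s in 0..(q : ℝ) * p, e' s * φ s| + |∫ s in (q : ℝ) * p..t, e' s * φ s| :=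
        abs_add_le _ _
    _ ≤ 2 * ε * T + 2 * N * p := add_le_add hfull hrest

/-! ### Several periods of one square wave -/

/-- **`r` consecutive periods**: `∫_{4nH}^{4(n+r)H} wave c H = r · H Σⱼ cⱼ`.
[cite: Ozanski2017NSISingular, §4.3 (4.25)] -/
theorem integral_wave_periods {H : ℝ} (hH : 0 < H) (c : Fin 4 → ℝ) (n r : ℕ) :
    ∫ s in (((4 * n : ℕ) : ℝ) * H)..(((4 * (n + r) : ℕ) : ℝ) * H), wave c H s =
      r * (H * ∑ j, c j) := by
  have hmem : ∀ m : ℕ, m ≤ n + r → ((4 * m : ℕ) : ℝ) * H ∈ Icc 0 (((4 * (n + r) : ℕ) : ℝ) * H) :=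
    fun m hm => ⟨by positivity, by
      have : ((4 * m : ℕ) : ℝ) ≤ ((4 * (n + r) : ℕ) : ℝ) := by exact_mod_cast (by omega)
      exact mul_le_mul_of_nonneg_right this hH.le⟩
  have hint : ∀ m ∈ Ico n (n + r), IntervalIntegrable (wave c H) volume
      (((4 * m : ℕ) : ℝ) * H) (((4 * (m + 1) : ℕ) : ℝ) * H) := fun m hm => by
    have := intervalIntegrable_wave_mul_of_mem hH c (ψ := fun _ => 1) (n := 4 * (n + r))
      continuousOn_const (hmem m hm.2.le) (hmem (m + 1) hm.2)
    simpa using this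
  have hsum := sum_integral_adjacent_intervals_Ico (f := wave c H) (μ := volume)
    (a := fun m : ℕ => ((4 * m : ℕ) : ℝ) * H) (m := n) (n := n + r) (Nat.le_add_right n r) hint
  rw [← hsum]
  have hterm : ∀ m ∈ Finset.Ico n (n + r),
      ∫ s in (((4 * m : ℕ) : ℝ) * H)..(((4 * (m + 1) : ℕ) : ℝ) * H), wave c H s = H * ∑ j, c j :=
    fun m _ => by
    have e : (((4 * (m + 1) : ℕ) : ℝ)) * H = ((4 * m + 4 : ℕ) : ℝ) * H := by push_cast; ring
    rw [e]
    exact integral_wave_period hH c m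
  rw [Finset.sum_congr rfl hterm, Finset.sum_const, Nat.card_Ico, Nat.add_sub_cancel_left,
    nsmul_eq_mul]

/-- `4 · 4^{d-1} = 4^d` for `d ≥ 1`. [folklore] -/
theorem four_mul_pow_pred {d : ℕ} (hd : 0 < d) : (4 : ℝ) * 4 ^ (d - 1) = 4 ^ d := by
  rw [← pow_succ', Nat.sub_add_cancel hd]

/-! ### Multi-frequency patterns: a fast wave against a slow one -/

/-- Pointwise: a product `wave c H · g(wave c' H)` of a square wave with a function of a square
wave OF THE SAME quarter length is the square wave with quarter values `c_q g(c'_q)`. [folklore] -/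
theorem wave_mul_apply_wave (c c' : Fin 4 → ℝ) (g : ℝ → ℝ) (H s : ℝ) :
    wave c H s * g (wave c' H s) = wave (fun q => c q * g (c' q)) H s :=
  rfl

/-- Pointwise: `g ∘ wave c' H = wave (g ∘ c') H`. [folklore] -/
theorem apply_wave (c' : Fin 4 → ℝ) (g : ℝ → ℝ) (H s : ℝ) :
    g (wave c' H s) = wave (fun q => g (c' q)) H s :=
  rfl

/-- **A fast wave over one quarter of a slow one** (`d ≥ 1`): on the quarter
`[m·4ᵈH, (m+1)·4ᵈH]` of the slow wave `wave c' (4ᵈH)` the factor `g(wave c' (4ᵈH)) = g(c'_{m mod 4})`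
is constant and the fast wave `wave c H` runs through `4^{d-1}` whole periods:
`∫ wave c H · g(wave c' (4ᵈH)) = g(c'_{m mod 4}) · 4^{d-1} H Σⱼ cⱼ` (the block computation behind
Ożański's (6.28) for `𝔫 ≠ 𝔪`). [cite: Ozanski2017NSISingular, §6.4 (6.28)–(6.29)] -/
theorem integral_wave_mul_coarse_quarter {H : ℝ} (hH : 0 < H) {d : ℕ} (hd : 0 < d)
    (c c' : Fin 4 → ℝ) (g : ℝ → ℝ) (m : ℕ) :
    ∫ s in ((m : ℝ) * (4 ^ d * H))..(((m : ℝ) + 1) * (4 ^ d * H)),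
        wave c H s * g (wave c' (4 ^ d * H) s) =
      g (c' ⟨m % 4, Nat.mod_lt _ (by norm_num)⟩) * (4 ^ (d - 1) * (H * ∑ j, c j)) := by
  have hH' : 0 < 4 ^ d * H := by positivity
  have hle : (m : ℝ) * (4 ^ d * H) ≤ ((m : ℝ) + 1) * (4 ^ d * H) := by nlinarith
  rw [integral_congr_uIoo (g := fun s => wave c H s * g (c' ⟨m % 4, Nat.mod_lt _ (by norm_num)⟩))
    (by
      rw [uIoo_of_le hle]
      intro s hs
      simp only [wave_eqOn hH' c' m hs]),
    intervalIntegral.integral_mul_const]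
  have e1 : (m : ℝ) * (4 ^ d * H) = ((4 * (4 ^ (d - 1) * m) : ℕ) : ℝ) * H := by
    push_cast
    rw [← four_mul_pow_pred hd]
    ring
  have e2 : ((m : ℝ) + 1) * (4 ^ d * H) = ((4 * (4 ^ (d - 1) * m + 4 ^ (d - 1)) : ℕ) : ℝ) * H := by
    push_cast
    rw [← four_mul_pow_pred hd]
    ring
  rw [e1, e2, integral_wave_periods hH c (4 ^ (d - 1) * m) (4 ^ (d - 1))]
  push_cast
  ring

/-- **A slow wave against a function of a fast one, one slow quarter** (`d ≥ 1`): on the quarter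
`[m·4ᵈH', (m+1)·4ᵈH']` the slow wave `wave c (4ᵈH') = c_{m mod 4}` is constant and
`g(wave c' H') = wave (g ∘ c') H'` runs through `4^{d-1}` whole periods:
`∫ wave c (4ᵈH') · g(wave c' H') = c_{m mod 4} · 4^{d-1} H' Σⱼ g(c'ⱼ)`.
[cite: Ozanski2017NSISingular, §6.4 (6.28)–(6.29)] -/
theorem integral_wave_mul_fine_quarter {H' : ℝ} (hH' : 0 < H') {d : ℕ} (hd : 0 < d)
    (c c' : Fin 4 → ℝ) (g : ℝ → ℝ) (m : ℕ) :
    ∫ s in ((m : ℝ) * (4 ^ d * H'))..(((m : ℝ) + 1) * (4 ^ d * H')),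
        wave c (4 ^ d * H') s * g (wave c' H' s) =
      c ⟨m % 4, Nat.mod_lt _ (by norm_num)⟩ * (4 ^ (d - 1) * (H' * ∑ j, g (c' j))) := by
  have hH : 0 < 4 ^ d * H' := by positivity
  have hle : (m : ℝ) * (4 ^ d * H') ≤ ((m : ℝ) + 1) * (4 ^ d * H') := by nlinarith
  rw [integral_congr_uIoo (g := fun s => c ⟨m % 4, Nat.mod_lt _ (by norm_num)⟩ *
      wave (fun q => g (c' q)) H' s)
    (by
      rw [uIoo_of_le hle]
      intro s hs
      simp only [wave_eqOn hH c m hs]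
      rfl),
    intervalIntegral.integral_const_mul]
  have e1 : (m : ℝ) * (4 ^ d * H') = ((4 * (4 ^ (d - 1) * m) : ℕ) : ℝ) * H' := by
    push_cast
    rw [← four_mul_pow_pred hd]
    ring
  have e2 : ((m : ℝ) + 1) * (4 ^ d * H') =
      ((4 * (4 ^ (d - 1) * m + 4 ^ (d - 1)) : ℕ) : ℝ) * H' := by
    push_cast
    rw [← four_mul_pow_pred hd]
    ring
  rw [e1, e2, integral_wave_periods hH' _ (4 ^ (d - 1) * m) (4 ^ (d - 1))]
  push_cast
  ring

/-- **One period of the slow wave against a function of a fast one**: the four quarter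
contributions `c_q · C` add up to `(Σ c_q) · C`, which vanishes for Ożański's zero-mean quarter
values. [cite: Ozanski2017NSISingular, §6.4 (6.28)–(6.29)] -/
theorem integral_wave_mul_fine_period {H' : ℝ} (hH' : 0 < H') {d : ℕ} (hd : 0 < d)
    (c c' : Fin 4 → ℝ) (g : ℝ → ℝ) (n : ℕ) :
    ∫ s in (((4 * n : ℕ) : ℝ) * (4 ^ d * H'))..(((4 * n + 4 : ℕ) : ℝ) * (4 ^ d * H')),
        wave c (4 ^ d * H') s * g (wave c' H' s) =
      (∑ j, c j) * (4 ^ (d - 1) * (H' * ∑ j, g (c' j))) := by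
  set H : ℝ := 4 ^ d * H' with hHdef
  have hH : 0 < H := by positivity
  set f : ℝ → ℝ := fun s => wave c H s * g (wave c' H' s) with hf
  -- integrability on the quarters, from cellwise constancy on the fine grid
  have hcell : ∀ N : ℕ, IsCellConst H' (4 ^ d * N) f := fun N =>
    (isCellConst_wave_pow hH' c d N).mul
      (((isCellConst_wave hH' c' (4 ^ d * N))).comp g)
  have hint : ∀ i < 4, IntervalIntegrable f volume (((4 * n + i : ℕ) : ℝ) * H)
      (((4 * n + (i + 1) : ℕ) : ℝ) * H) := fun i hi => by
    have hN : ∀ m : ℕ, m ≤ 4 * n + 4 → ((m : ℕ) : ℝ) * H ∈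
        Icc 0 (((4 ^ d * (4 * n + 4) : ℕ) : ℝ) * H') := fun m hm => by
      refine ⟨by positivity, ?_⟩
      have : (m : ℝ) ≤ (4 * n + 4 : ℕ) := by exact_mod_cast hm
      calc (m : ℝ) * H ≤ ((4 * n + 4 : ℕ) : ℝ) * H := mul_le_mul_of_nonneg_right this hH.le
        _ = ((4 ^ d * (4 * n + 4) : ℕ) : ℝ) * H' := by rw [hHdef]; push_cast; ring
    exact (hcell (4 * n + 4)).intervalIntegrable_of_mem hH' (hN _ (by omega)) (hN _ (by omega))
  have key := sum_integral_adjacent_intervals (f := f) (μ := volume)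
    (a := fun i : ℕ => ((4 * n + i : ℕ) : ℝ) * H) (n := 4) hint
  simp only [add_zero] at key
  have e : ∀ i : ℕ, (((4 * n + (i + 1) : ℕ) : ℝ)) = ((4 * n + i : ℕ) : ℝ) + 1 := fun i => by
    push_cast; ring
  have term : ∀ i : ℕ, ∫ s in (((4 * n + i : ℕ) : ℝ) * H)..(((4 * n + (i + 1) : ℕ) : ℝ) * H),
      f s = c ⟨(4 * n + i) % 4, Nat.mod_lt _ (by norm_num)⟩ * (4 ^ (d - 1) * (H' * ∑ j, g (c' j))) :=
    fun i => by
    rw [e i]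
    exact integral_wave_mul_fine_quarter hH' hd c c' g (4 * n + i)
  have e4 : (((4 * n + 4 : ℕ) : ℝ)) = ((4 * n + (3 + 1) : ℕ) : ℝ) := by push_cast; ring
  rw [e4, ← key, Finset.sum_range_succ, Finset.sum_range_succ, Finset.sum_range_succ,
    Finset.sum_range_succ, Finset.sum_range_zero, zero_add, term 0, term 1, term 2, term 3]
  have f0 : (⟨(4 * n + 0) % 4, Nat.mod_lt _ (by norm_num)⟩ : Fin 4) = 0 :=
    Fin.ext (show (4 * n + 0) % 4 = 0 by omega)
  have f1 : (⟨(4 * n + 1) % 4, Nat.mod_lt _ (by norm_num)⟩ : Fin 4) = 1 :=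
    Fin.ext (show (4 * n + 1) % 4 = 1 by omega)
  have f2 : (⟨(4 * n + 2) % 4, Nat.mod_lt _ (by norm_num)⟩ : Fin 4) = 2 :=
    Fin.ext (show (4 * n + 2) % 4 = 2 by omega)
  have f3 : (⟨(4 * n + 3) % 4, Nat.mod_lt _ (by norm_num)⟩ : Fin 4) = 3 :=
    Fin.ext (show (4 * n + 3) % 4 = 3 by omega)
  rw [f0, f1, f2, f3]
  simp only [Fin.sum_univ_four]
  ring

/-! ### Period integrals over a common period `P = 4^{A+1} h` -/

/-- `4ᵃ · 4 · 4^{A-a} = 4^{A+1}` for `a ≤ A`. [folklore] -/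
theorem pow_mul_four_mul_pow_sub {A a : ℕ} (ha : a ≤ A) :
    (4 : ℝ) ^ a * (4 * 4 ^ (A - a)) = 4 ^ (A + 1) := by
  rw [mul_left_comm, ← pow_add, Nat.add_sub_cancel' ha, pow_succ']

/-- **A single wave over a common period**: for `a ≤ A`, `H = 4ᵃh`, `P = 4^{A+1}h`,
`∫_{αP}^{(α+1)P} wave c H = P · (Σⱼcⱼ)/4` (`4^{A-a}` whole periods).
[cite: Ozanski2017NSISingular, §4.3 (4.25) and §6.4 (6.29)] -/
theorem integral_wave_commonPeriod {h : ℝ} (hh : 0 < h) (c : Fin 4 → ℝ) {A a : ℕ} (ha : a ≤ A)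
    (α : ℕ) :
    ∫ s in ((α : ℝ) * (4 ^ (A + 1) * h))..(((α : ℝ) + 1) * (4 ^ (A + 1) * h)),
        wave c (4 ^ a * h) s = 4 ^ (A + 1) * h * ((∑ j, c j) / 4) := by
  have hH : 0 < 4 ^ a * h := by positivity
  have e1 : (α : ℝ) * (4 ^ (A + 1) * h) = ((4 * (α * 4 ^ (A - a)) : ℕ) : ℝ) * (4 ^ a * h) := by
    push_cast
    rw [← pow_mul_four_mul_pow_sub ha]
    ring
  have e2 : ((α : ℝ) + 1) * (4 ^ (A + 1) * h) =
      ((4 * (α * 4 ^ (A - a) + 4 ^ (A - a)) : ℕ) : ℝ) * (4 ^ a * h) := by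
    push_cast
    rw [← pow_mul_four_mul_pow_sub ha]
    ring
  rw [e1, e2, integral_wave_periods hH c (α * 4 ^ (A - a)) (4 ^ (A - a))]
  push_cast
  rw [← pow_mul_four_mul_pow_sub ha]
  ring

/-- **Two waves of the same frequency over a common period**: for `a ≤ A`,
`∫_{αP}^{(α+1)P} wave c (4ᵃh) · g(wave c' (4ᵃh)) = P · (Σ_q c_q g(c'_q))/4` (the case `𝔫 = 𝔪`
of (6.28)). [cite: Ozanski2017NSISingular, §6.4 (6.28)] -/
theorem integral_wave_mul_wave_commonPeriod_self {h : ℝ} (hh : 0 < h) (c c' : Fin 4 → ℝ)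
    (g : ℝ → ℝ) {A a : ℕ} (ha : a ≤ A) (α : ℕ) :
    ∫ s in ((α : ℝ) * (4 ^ (A + 1) * h))..(((α : ℝ) + 1) * (4 ^ (A + 1) * h)),
        wave c (4 ^ a * h) s * g (wave c' (4 ^ a * h) s) =
      4 ^ (A + 1) * h * ((∑ q, c q * g (c' q)) / 4) := by
  simp_rw [wave_mul_apply_wave]
  exact integral_wave_commonPeriod hh _ ha α

/-- **Two waves of different frequencies over a common period**: for `a, a' ≤ A`, `a ≠ a'`, and
zero-mean quarter values `Σ c = 0`,
`∫_{αP}^{(α+1)P} wave c (4ᵃh) · g(wave c' (4ᵃ'h)) = 0` (the case `𝔫 ≠ 𝔪` of (6.28): on each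
quarter of the slower wave the faster one runs through whole periods, and either the faster is
`wave c` with `∫_{period} wave c = 0`, or the slower is `wave c`, constant `c_q` on its quarters,
with `Σ_q c_q = 0` over each of its periods). [cite: Ozanski2017NSISingular, §6.4 (6.28)–(6.29)] -/
theorem integral_wave_mul_wave_commonPeriod_of_ne {h : ℝ} (hh : 0 < h) {c : Fin 4 → ℝ}
    (hc : ∑ j, c j = 0) (c' : Fin 4 → ℝ) (g : ℝ → ℝ) {A a a' : ℕ} (ha : a ≤ A) (ha' : a' ≤ A)
    (hne : a ≠ a') (α : ℕ) :
    ∫ s in ((α : ℝ) * (4 ^ (A + 1) * h))..(((α : ℝ) + 1) * (4 ^ (A + 1) * h)),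
        wave c (4 ^ a * h) s * g (wave c' (4 ^ a' * h) s) = 0 := by
  set f : ℝ → ℝ := fun s => wave c (4 ^ a * h) s * g (wave c' (4 ^ a' * h) s) with hf
  -- integrability on subintervals of `[0, (α+1)P]`, from cellwise constancy on the fine grid
  have hcell : ∀ N : ℕ, IsCellConst h (4 ^ (A + 1) * N) f := fun N => by
    have h1 : IsCellConst h (4 ^ (A + 1) * N) (wave c (4 ^ a * h)) := by
      have := isCellConst_wave_pow hh c a (4 ^ (A + 1 - a) * N)
      rwa [← mul_assoc, ← pow_add, Nat.add_sub_cancel' (ha.trans (Nat.le_succ A))] at this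
    have h2 : IsCellConst h (4 ^ (A + 1) * N) (wave c' (4 ^ a' * h)) := by
      have := isCellConst_wave_pow hh c' a' (4 ^ (A + 1 - a') * N)
      rwa [← mul_assoc, ← pow_add, Nat.add_sub_cancel' (ha'.trans (Nat.le_succ A))] at this
    exact h1.mul (h2.comp g)
  have hI : ∀ {u v : ℝ}, u ∈ Icc 0 (((α : ℝ) + 1) * (4 ^ (A + 1) * h)) →
      v ∈ Icc 0 (((α : ℝ) + 1) * (4 ^ (A + 1) * h)) → IntervalIntegrable f volume u v :=
    fun {u v} hu hv => by
    have e : (((4 ^ (A + 1) * (α + 1) : ℕ) : ℝ)) * h = ((α : ℝ) + 1) * (4 ^ (A + 1) * h) := by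
      push_cast; ring
    exact (hcell (α + 1)).intervalIntegrable_of_mem hh (e.symm ▸ hu) (e.symm ▸ hv)
  rcases lt_or_gt_of_ne hne with hlt | hlt
  · -- `wave c` is the faster wave: sum over the quarters of `wave c'`
    obtain ⟨d, hd, rfl⟩ : ∃ d, 0 < d ∧ a' = a + d := ⟨a' - a, Nat.sub_pos_of_lt hlt, by omega⟩
    have hH : 0 < 4 ^ a * h := by positivity
    -- the common period consists of `4^{A+1-(a+d)}` quarters of the slow wave
    set L : ℕ := 4 ^ (A + 1 - (a + d)) with hL
    have hHL : (L : ℝ) * (4 ^ d * (4 ^ a * h)) = 4 ^ (A + 1) * h := by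
      rw [hL]; push_cast
      rw [← mul_assoc, ← mul_assoc, ← pow_add, ← pow_add,
        show A + 1 - (a + d) + d + a = A + 1 by omega]
    have hsum := sum_integral_adjacent_intervals_Ico (f := f) (μ := volume)
      (a := fun m : ℕ => (m : ℝ) * (4 ^ d * (4 ^ a * h))) (m := α * L) (n := (α + 1) * L)
      (by nlinarith) fun m hm => hI ?_ ?_
    rotate_left
    · refine ⟨by positivity, ?_⟩
      have : (m : ℝ) ≤ (α + 1) * L := by exact_mod_cast hm.2.le
      calc (m : ℝ) * (4 ^ d * (4 ^ a * h)) ≤ ((α : ℝ) + 1) * L * (4 ^ d * (4 ^ a * h)) := by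
            gcongr
        _ = ((α : ℝ) + 1) * (4 ^ (A + 1) * h) := by rw [mul_assoc, hHL]
    · refine ⟨by positivity, ?_⟩
      have : ((m + 1 : ℕ) : ℝ) ≤ (α + 1) * L := by exact_mod_cast hm.2
      calc ((m + 1 : ℕ) : ℝ) * (4 ^ d * (4 ^ a * h)) ≤ ((α : ℝ) + 1) * L * (4 ^ d * (4 ^ a * h)) := by
            gcongr
        _ = ((α : ℝ) + 1) * (4 ^ (A + 1) * h) := by rw [mul_assoc, hHL]
    have e1 : ((α * L : ℕ) : ℝ) * (4 ^ d * (4 ^ a * h)) = (α : ℝ) * (4 ^ (A + 1) * h) := by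
      push_cast; rw [mul_assoc, hHL]
    have e2 : (((α + 1) * L : ℕ) : ℝ) * (4 ^ d * (4 ^ a * h)) = ((α : ℝ) + 1) * (4 ^ (A + 1) * h) := by
      push_cast; rw [mul_assoc, hHL]
    rw [e1, e2] at hsum
    rw [← hsum]
    refine Finset.sum_eq_zero fun m _ => ?_
    have e3 : (((m + 1 : ℕ) : ℝ)) = (m : ℝ) + 1 := by push_cast; ring
    rw [e3, hf]
    simp only
    rw [show (4 : ℝ) ^ (a + d) * h = 4 ^ d * (4 ^ a * h) by rw [pow_add]; ring,
      integral_wave_mul_coarse_quarter hH hd c c' g m, hc]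
    ring
  · -- `wave c` is the slower wave: sum over its periods
    obtain ⟨d, hd, rfl⟩ : ∃ d, 0 < d ∧ a = a' + d := ⟨a - a', Nat.sub_pos_of_lt hlt, by omega⟩
    have hH' : 0 < 4 ^ a' * h := by positivity
    -- the common period consists of `4^{A-(a'+d)}` periods of the slow wave
    set L : ℕ := 4 ^ (A - (a' + d)) with hL
    have hHL : (4 : ℝ) * L * (4 ^ d * (4 ^ a' * h)) = 4 ^ (A + 1) * h := by
      rw [hL]; push_cast
      rw [← pow_succ', ← mul_assoc, ← mul_assoc, ← pow_add, ← pow_add,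
        show A - (a' + d) + 1 + d + a' = A + 1 by omega]
    have hsum := sum_integral_adjacent_intervals_Ico (f := f) (μ := volume)
      (a := fun n : ℕ => ((4 * n : ℕ) : ℝ) * (4 ^ d * (4 ^ a' * h))) (m := α * L)
      (n := (α + 1) * L) (by nlinarith) fun n hn => hI ?_ ?_
    rotate_left
    · refine ⟨by positivity, ?_⟩
      have : ((4 * n : ℕ) : ℝ) ≤ 4 * ((α + 1) * L) := by exact_mod_cast (by nlinarith [hn.2])
      calc ((4 * n : ℕ) : ℝ) * (4 ^ d * (4 ^ a' * h))
          ≤ 4 * (((α : ℝ) + 1) * L) * (4 ^ d * (4 ^ a' * h)) := by gcongr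
        _ = ((α : ℝ) + 1) * (4 ^ (A + 1) * h) := by rw [← hHL]; ring
    · refine ⟨by positivity, ?_⟩
      have : ((4 * (n + 1) : ℕ) : ℝ) ≤ 4 * ((α + 1) * L) := by
        exact_mod_cast (by nlinarith [hn.2])
      calc ((4 * (n + 1) : ℕ) : ℝ) * (4 ^ d * (4 ^ a' * h))
          ≤ 4 * (((α : ℝ) + 1) * L) * (4 ^ d * (4 ^ a' * h)) := by gcongr
        _ = ((α : ℝ) + 1) * (4 ^ (A + 1) * h) := by rw [← hHL]; ring
    have e1 : ((4 * (α * L) : ℕ) : ℝ) * (4 ^ d * (4 ^ a' * h)) = (α : ℝ) * (4 ^ (A + 1) * h) := by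
      push_cast; rw [← hHL]; ring
    have e2 : ((4 * ((α + 1) * L) : ℕ) : ℝ) * (4 ^ d * (4 ^ a' * h)) =
        ((α : ℝ) + 1) * (4 ^ (A + 1) * h) := by
      push_cast; rw [← hHL]; ring
    rw [e1, e2] at hsum
    rw [← hsum]
    refine Finset.sum_eq_zero fun n _ => ?_
    have e3 : (((4 * (n + 1) : ℕ) : ℝ)) = ((4 * n + 4 : ℕ) : ℝ) := by push_cast; ring
    rw [e3, hf]
    simp only
    rw [show (4 : ℝ) ^ (a' + d) * h = 4 ^ d * (4 ^ a' * h) by rw [pow_add]; ring,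
      integral_wave_mul_fine_period hH' hd c c' g n, hc]
    ring

/-! ### Ożański's quarter values: the discrete form of (6.28) -/

/-- The three values `1, -1, 0` taken by Ożański's basic processes. [cite: Ozanski2017NSISingular, §4.3 (4.24)] -/
def basicValues : Fin 3 → ℝ :=
  ![1, -1, 0]

/-- The quarter values take values in `{1, -1, 0}`. [cite: Ozanski2017NSISingular, §4.3 (4.24)] -/
theorem quarterValues_mem (i : Fin 2) (q : Fin 4) :
    ∃ b : Fin 3, quarterValues i q = basicValues b := by
  fin_cases i <;> fin_cases q
  · exact ⟨0, by simp [quarterValues, quarterValues₁, basicValues]⟩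
  · exact ⟨1, by simp [quarterValues, quarterValues₁, basicValues]⟩
  · exact ⟨2, by simp [quarterValues, quarterValues₁, basicValues]⟩
  · exact ⟨2, by simp [quarterValues, quarterValues₁, basicValues]⟩
  · exact ⟨0, by simp [quarterValues, quarterValues₂, basicValues]⟩
  · exact ⟨0, by simp [quarterValues, quarterValues₂, basicValues]⟩
  · exact ⟨1, by simp [quarterValues, quarterValues₂, basicValues]⟩
  · exact ⟨1, by simp [quarterValues, quarterValues₂, basicValues]⟩

/-- The quarter values have mean zero (`∫₀ᵀ bᵢ = 0`). [cite: Ozanski2017NSISingular, §4.3 (4.25)] -/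
theorem sum_quarterValues (i : Fin 2) : ∑ q, quarterValues i q = 0 := by
  fin_cases i <;> simp [quarterValues, quarterValues₁, quarterValues₂, Fin.sum_univ_four]

/-- **Decomposition over the basic values**: a function of a `{1,-1,0}`-valued quantity `w` is
the sum of its values weighted by the indicators, `f(w) = Σ_b [w = b] f(b)`. [folklore] -/
theorem apply_eq_sum_indicator_basicValues (f : ℝ → ℝ) {w : ℝ} (hw : ∃ b : Fin 3, w = basicValues b) :
    f w = ∑ b : Fin 3, (if w = basicValues b then 1 else 0) * f (basicValues b) := by
  obtain ⟨b, rfl⟩ := hw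
  fin_cases b <;> simp [basicValues, Fin.sum_univ_three] <;> norm_num

/-- **The discrete form of Ożański's (6.28)** ("`∫₀ᵀ b_i^{(𝔪)} f(b_l^{(𝔪)}) = T/2(f(1) - f(0))`
for `(i,l) = (2,1)` and `0` otherwise, for `f(-1) = f(1)`"; here per period, divided by the period
length): with `c¹ = (1,-1,0,0)`, `c² = (1,1,-1,-1)` (`quarterValues 0, 1`),
`¼ Σ_q cⁱ_q f(cˡ_q) = ½(f(1) - f(0))` if `(i,l) = (1,0)` (his `(2,1)`) and `= 0` otherwise.
[cite: Ozanski2017NSISingular, §6.4 (6.28) and §4.3 (4.25)] -/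
theorem sum_quarterValues_mul_apply {f : ℝ → ℝ} (hf : f (-1) = f 1) (i l : Fin 2) :
    (∑ q, quarterValues i q * f (quarterValues l q)) / 4 =
      if i = 1 ∧ l = 0 then (f 1 - f 0) / 2 else 0 := by
  fin_cases i <;> fin_cases l <;>
    simp [quarterValues, quarterValues₁, quarterValues₂, Fin.sum_univ_four, hf]
  ring

end Scheffer

end Literature.Barriers.NavierStokesRegularity
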